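import Literature.AlgebraicGeometry.RelativeSpec.FiniteGroupQuotientGluedProperties
import Literature.AlgebraicGeometry.RelativeSpec.FiniteGroupQuotientGenericEtale
import Literature.AlgebraicGeometry.RelativeSpec.FiniteGroupQuotientFinsetAffine
import Literature.AlgebraicGeometry.RelativeSpec.GermSubfieldSpec
import Literature.AlgebraicGeometry.Motives.FrobeniusMorphism
import Mathlib.AlgebraicGeometry.Morphisms.Integral
import Mathlib.AlgebraicGeometry.Morphisms.Proper
import Mathlib.Algebra.CharP.Algebra
import Mathlib.Algebra.CharP.Frobenius
import HarnessLib

/-!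
# The Frobenius-twisted base of a Galois alteration

Let `k` be a field of characteristic `p`, `X/k` integral, separated, of finite type, with every
finite subset in an affine open, and let `π : X₁ → X` be a proper dominant morphism from an
integral `X₁`, invariant under an action `ρ` of a finite group `G` on `X₁`, with every finite
subset of `X₁` in an affine open (de Jong's Galois alteration datum, de Jong 1997, 5.3). For the
construction of the **level-`n` infinitesimal quotient** of `X₁` — the normal model of the
subfield `Mₙ = K·L^{pⁿ}` of `L = K(X₁)`, `K = π^* K(X)` — as a relative spectrum one needs an
AFFINE, `G`-INVARIANT morphism `f' : X₁ → Y` over `X` all of whose sections have generic germs in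
`Mₙ`. This file constructs it (`exists_frobeniusTwistedBase`):

  `Y = (X₁/G) × X`, `f' = (Frⁿ ≫ q, π)`,

where `q : X₁ → X₁/G` is the quotient by `G` (glued over `Spec k`,
`Literature.AlgebraicGeometry.RelativeSpec.FiniteGroupQuotientGluing`) and `Frⁿ` the `pⁿ`-power
endomorphism (`Literature.AlgebraicGeometry.Motives.powEndo`). Then `f'` is integral (`Frⁿ` is
integral, `q` finite, and `(X₁/G) × X → X₁/G` separated), locally of finite type (`f' ≫ pr₂ = π`),
`G`-invariant (`Frⁿ` commutes with everything, `q` and `π` are invariant), and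
`Spec L → X₁ → Y` factors through `Spec Mₙ` (`a ↦ a^{pⁿ}` lands in `L^{pⁿ} ⊆ Mₙ`, `π^*` in `K`),
so that germs of `f'^*`-sections lie in `Mₙ`
(`RelativeSpec.germ_app_mem_of_fromSpecStalk_comp_eq`); finally finite subsets of `Y` lie in
affine opens (`RelativeSpec.exists_isAffineOpen_finset_subset_pullback`). The product is taken
over `Spec ℤ` (the terminal scheme), which avoids twisting the `k`-structure by the Frobenius of
`k`.

## References

* A. J. de Jong, *Families of curves and alterations*, Ann. Inst. Fourier 47 (1997), 5.3,
  Thm. 5.13. [DeJong1997]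
* D. Mumford, *Abelian Varieties* (1970), §7, Thm. p. 66. [MumfordAV1970]
-/

noncomputable section

universe u

open CategoryTheory Limits AlgebraicGeometry
open Literature.AlgebraicGeometry.RelativeSpec
open Literature.AlgebraicGeometry.Motives Literature.AlgebraicGeometry.Motives.RatFn

namespace Literature.AlgebraicGeometry.Resolution

set_option backward.isDefEq.respectTransparency false in
/-- **The Frobenius-twisted base.** For de Jong's datum (`π : X₁ → X` proper dominant and
`G`-invariant, finite subsets of `X₁` and of `X` in affine opens, `X/k` separated of finite
type, `char k = p`) there are a scheme `Y`, an integral, locally of finite type, `G`-invariant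
`f' : X₁ → Y` and a separated `v₀ : Y → X` with `f' ≫ v₀ = π`, such that the generic germ of
every `f'^*`-section lies in `Mₙ = closure (π^*K(X) ∪ L^{pⁿ})` and every finite subset of `Y`
lies in an affine open. (`Y = (X₁/G) × X`, `f' = (Frⁿ ≫ q, π)`; de Jong 1997, 5.3, the base of
the infinitesimal quotients.) [cite: DeJong1997, 5.3 and Thm. 5.13] -/
theorem exists_frobeniusTwistedBase {k : Type u} [Field k] (p n : ℕ) [Fact p.Prime] [CharP k p]
    {X : Scheme.{u}} [IsIntegral X] (f : X ⟶ Spec (.of k)) [IsSeparated f]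
    [LocallyOfFiniteType f] [QuasiCompact f]
    (hXaff : ∀ S : Finset X, ∃ U : X.Opens, IsAffineOpen U ∧ (↑S : Set X) ⊆ U)
    {G : Type u} [Group G] [Finite G] {X₁ : Scheme.{u}} [IsIntegral X₁]
    (ρ : G →* Aut X₁) (π : X₁ ⟶ X) [IsDominant π] [IsProper π]
    (hinv : ∀ g : G, (ρ g).hom ≫ π = π)
    (h1aff : ∀ S : Finset X₁, ∃ U : X₁.Opens, IsAffineOpen U ∧ (↑S : Set X₁) ⊆ U) :
    ∃ (Y : Scheme.{u}) (f' : X₁ ⟶ Y) (_ : IsIntegralHom f') (_ : LocallyOfFiniteType f')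
      (v₀ : Y ⟶ X) (_ : IsSeparated v₀), f' ≫ v₀ = π ∧ (∀ g : G, (ρ g).hom ≫ f' = f') ∧
      (∀ (U : Y.Opens) (a : Γ(Y, U)) (h : genericPoint X₁ ∈ f' ⁻¹ᵁ U),
        X₁.presheaf.germ (f' ⁻¹ᵁ U) (genericPoint X₁) h (f'.app U a) ∈
          Subfield.closure (Set.range (functionFieldMap π) ∪
            Set.range fun a : X₁.functionField => a ^ p ^ n)) ∧
      (∀ S : Finset Y, ∃ W : Y.Opens, IsAffineOpen W ∧ (↑S : Set Y) ⊆ W) := by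
  classical
  haveI : Fintype G := Fintype.ofFinite G
  have hp : p.Prime := Fact.out
  set M : Subfield X₁.functionField := Subfield.closure (Set.range (functionFieldMap π) ∪
    Set.range fun a : X₁.functionField => a ^ p ^ n) with hMdef
  haveI : X.IsSeparated := ⟨by rw [← terminal.comp_from f]; infer_instance⟩
  -- the action over `Spec k` and the covering by `G`-stable affine opens
  let r : X₁ ⟶ Spec (.of k) := π ≫ f
  let ρA : ActionOver r G := ⟨ρ, fun g ↦ by
    change (ρ g).hom ≫ π ≫ f = π ≫ f
    rw [← Category.assoc, hinv g]⟩
  haveI : IsSeparated r := inferInstanceAs (IsSeparated (π ≫ f))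
  haveI : LocallyOfFiniteType r := inferInstanceAs (LocallyOfFiniteType (π ≫ f))
  haveI : QuasiCompact r := inferInstanceAs (QuasiCompact (π ≫ f))
  haveI : X₁.IsSeparated := ⟨by rw [← terminal.comp_from r]; infer_instance⟩
  have hcov : ∀ x : X₁, ∃ O : ρA.StableAffineOpens, x ∈ O.1 := by
    intro x
    obtain ⟨U, hU, hS⟩ := h1aff (Finset.univ.image fun g : G ↦ (ρ g).hom x)
    obtain ⟨O, hx, -⟩ := ρA.exists_stableAffineOpen_le_of_orbit x U hU fun g ↦ hS (by
      simp only [Finset.coe_image, Finset.coe_univ, Set.image_univ, Set.mem_range]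
      exact ⟨g, rfl⟩)
    exact ⟨O, hx⟩
  -- the quotient `Q = X₁/G`
  let Q : Scheme.{u} := ρA.glued
  let qt : X₁ ⟶ Q := ρA.gluedMk hcov
  haveI : IsFinite qt := ρA.isFinite_gluedMk hcov
  have hqinv : ∀ g : G, (ρ g).hom ≫ qt = qt := ρA.aut_hom_gluedMk hcov
  haveI : Q.IsSeparated := by
    haveI := ρA.isSeparated_gluedDesc hcov r ρA.aut_comp
    exact ⟨by rw [show terminal.from Q = ρA.gluedDesc r ρA.aut_comp ≫ terminal.from _ from
      terminal.hom_ext _ _]; infer_instance⟩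
  have hQaff : ∀ S : Finset Q, ∃ W : Q.Opens, IsAffineOpen W ∧ (↑S : Set Q) ⊆ W :=
    ρA.exists_isAffineOpen_finset_subset_glued h1aff hcov
  -- the `pⁿ`-power endomorphism `Fr` of `X₁`
  have hp0 : (p : Γ(X₁, ⊤)) = 0 := by
    let φ : k →+* Γ(X₁, ⊤) := (r.appTop).hom.comp (Scheme.ΓSpecIso (.of k)).inv.hom
    rw [← map_natCast φ p, CharP.cast_eq_zero, map_zero]
  have hq : p ^ n ≠ 0 := pow_ne_zero n hp.ne_zero
  have hadd : ∀ (U : X₁.Opens) (a b : Γ(X₁, U)), (a + b) ^ p ^ n = a ^ p ^ n + b ^ p ^ n :=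
    fun U a b ↦ add_pow_prime_pow_of_natCast_eq_zero p (natCast_sections_eq_zero X₁ p hp0 U) n a b
  let Fr : X₁ ⟶ X₁ := powEndo X₁ (p ^ n) hq hadd
  haveI : IsAffineHom Fr := ⟨fun _ hU ↦ hU⟩
  haveI : IsIntegralHom Fr :=
    { isIntegral_app := fun U _ (a : Γ(X₁, U)) ↦ by
        refine ⟨Polynomial.X ^ p ^ n - Polynomial.C a, Polynomial.monic_X_pow_sub_C a hq, ?_⟩
        change Polynomial.eval₂ (powRingHom Γ(X₁, U) (p ^ n) hq (hadd U)) a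
          (Polynomial.X ^ p ^ n - Polynomial.C a) = 0
        rw [Polynomial.eval₂_sub, Polynomial.eval₂_X_pow, Polynomial.eval₂_C, powRingHom_apply,
          sub_self] }
  have hFrρ : ∀ g : G, Fr ≫ (ρ g).hom = (ρ g).hom ≫ Fr := fun g ↦
    powEndo_comp (p ^ n) hq hadd (ρ g).hom hadd
  -- the base `Y = Q × X` and `f' = (Fr ≫ qt, π)`
  let Y : Scheme.{u} := pullback (terminal.from Q) (terminal.from X)
  let f' : X₁ ⟶ Y := pullback.lift (Fr ≫ qt) π (terminal.hom_ext _ _)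
  have hf'1 : f' ≫ pullback.fst _ _ = Fr ≫ qt := pullback.lift_fst _ _ _
  have hf'2 : f' ≫ pullback.snd _ _ = π := pullback.lift_snd _ _ _
  haveI : IsIntegralHom f' := by
    have : IsIntegralHom (f' ≫ pullback.fst (terminal.from Q) (terminal.from X)) := by
      rw [hf'1]; infer_instance
    exact IsIntegralHom.of_comp f' (pullback.fst _ _)
  haveI : LocallyOfFiniteType f' := by
    have : LocallyOfFiniteType (f' ≫ pullback.snd (terminal.from Q) (terminal.from X)) := by
      rw [hf'2]; infer_instance
    exact locallyOfFiniteType_of_comp f' (pullback.snd _ _)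
  have hinvf' : ∀ g : G, (ρ g).hom ≫ f' = f' := fun g ↦ by
    apply pullback.hom_ext
    · rw [Category.assoc, hf'1, ← Category.assoc, ← hFrρ g, Category.assoc, hqinv g]
    · rw [Category.assoc, hf'2, hinv g]
  -- `Spec L → X₁ → Y` factors through `Spec M`
  haveI : CharP X₁.functionField p := by
    haveI : Nonempty (⊤ : X₁.Opens) := ⟨⟨genericPoint X₁, trivial⟩⟩
    exact (((X₁.germToFunctionField ⊤).hom.comp
      ((r.appTop).hom.comp (Scheme.ΓSpecIso (.of k)).inv.hom)).charP_iff_charP p).mp inferInstance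
  haveI : ExpChar X₁.functionField p := ExpChar.prime hp
  have hMpow : ∀ a : X₁.functionField, a ^ p ^ n ∈ M := fun a ↦
    Subfield.subset_closure (Or.inr ⟨a, rfl⟩)
  have hMπ : ∀ c, functionFieldMap π c ∈ M := fun c ↦ Subfield.subset_closure (Or.inl ⟨c, rfl⟩)
  let frobM : X₁.functionField →+* M := (iterateFrobenius X₁.functionField p n).codRestrict M
    fun a ↦ by rw [iterateFrobenius_def]; exact hMpow a
  let πM : X.functionField →+* M := (functionFieldMap π).codRestrict M hMπ
  have hfrobM : CommRingCat.ofHom frobM ≫ CommRingCat.ofHom M.subtype =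
      Fr.stalkMap (genericPoint X₁) := by
    apply CommRingCat.hom_ext
    ext t
    change t ^ p ^ n = _
    obtain ⟨U, hU, s, rfl⟩ := TopCat.Presheaf.exists_germ_eq X₁.presheaf t
    exact ((Scheme.Hom.germ_stalkMap_apply Fr U (genericPoint X₁) hU s).trans
      (map_pow (X₁.presheaf.germ U (genericPoint X₁) hU).hom s (p ^ n))).symm
  have hFr : Spec.map (CommRingCat.ofHom frobM ≫ CommRingCat.ofHom M.subtype) ≫
      X₁.fromSpecStalk (genericPoint X₁) = X₁.fromSpecStalk (genericPoint X₁) ≫ Fr := by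
    rw [hfrobM]
    exact Scheme.SpecMap_stalkMap_fromSpecStalk Fr
  have hπM : CommRingCat.ofHom πM ≫ CommRingCat.ofHom M.subtype =
      X.presheaf.stalkSpecializes (specializes_genericPoint π) ≫ π.stalkMap (genericPoint X₁) := by
    apply CommRingCat.hom_ext
    ext c
    rfl
  have hπ' : Spec.map (CommRingCat.ofHom πM ≫ CommRingCat.ofHom M.subtype) ≫
      X.fromSpecStalk (genericPoint X) = X₁.fromSpecStalk (genericPoint X₁) ≫ π := by
    rw [hπM, Spec.map_comp, Category.assoc, Scheme.SpecMap_stalkSpecializes_fromSpecStalk,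
      Scheme.SpecMap_stalkMap_fromSpecStalk]
  obtain ⟨m, hm1, hm2⟩ : ∃ m : Spec (CommRingCat.of M) ⟶ Y,
      m ≫ pullback.fst _ _ = Spec.map (CommRingCat.ofHom frobM) ≫
        X₁.fromSpecStalk (genericPoint X₁) ≫ qt ∧
      m ≫ pullback.snd _ _ = Spec.map (CommRingCat.ofHom πM) ≫ X.fromSpecStalk (genericPoint X) :=
    ⟨pullback.lift _ _ (terminal.hom_ext _ _), pullback.lift_fst _ _ _, pullback.lift_snd _ _ _⟩
  have hm : X₁.fromSpecStalk (genericPoint X₁) ≫ f' = Spec.map (CommRingCat.ofHom M.subtype) ≫ m := by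
    apply pullback.hom_ext
    · rw [Category.assoc, hf'1, Category.assoc, hm1, ← Spec.map_comp_assoc, ← Category.assoc, ← hFr,
        Category.assoc]
    · rw [Category.assoc, hf'2, Category.assoc, hm2, ← Spec.map_comp_assoc, hπ']
  have happ := germ_app_mem_of_fromSpecStalk_comp_eq (f := f') (M := M) m hm
  refine ⟨Y, f', inferInstance, inferInstance, pullback.snd _ _, inferInstance, hf'2, hinvf',
    happ, ?_⟩
  exact exists_isAffineOpen_finset_subset_pullback _ _ hQaff hXaff

end Literature.AlgebraicGeometry.Resolution

end
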